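import Literature.NumberTheory.Automorphic.MeyerSummationSchwartz
import Literature.NumberTheory.Automorphic.IdeleClassIntegration
import HarnessLib

/-!
# Norm shells in an idele class domain and integrability of Bruhat–Schwartz idele sums

Topic `NumberTheory/Automorphic`; namespace `Literature.NumberTheory.Automorphic`. THEOREMS ONLY
(no definition, no instance, no notation, no named fact, no `sorry`). Complements to
`IdeleClassIntegration` (Tate's volume computations along `u = log ‖x‖` inside a strict measurable
fundamental domain `𝓕 ⊆ 𝕀_K` for `Kˣ`, `IsIdeleClassDomain`, with the disintegration constant
`V = idelicCovolume K ν`) and to Meyer's Lemma 5.3 (`MeyerSummationSchwartz`: the idele sum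
`Σf(x) = ∑_{a ∈ Kˣ} f(a x) = Meyer.ideleSum K f x` of `f ∈ 𝒮(𝔸_K) = Meyer.schwartzBruhatAdele K`
decays faster than any `‖x‖^{-α}`, `α > 1`), for a number field `K` and ANY Haar measure `ν` on
`𝕀_K`. These are the measure-theoretic inputs of Tate's truncated zeta integral at `s = 1`
(`TateTruncatedZetaIntegral`, Rogawski's Lemma 7.1.1 [Rogawski1990, §7.1]):

* `measure_logNorm_preimage_Ico_inter` — `ν({a ≤ log ‖x‖ < b} ∩ 𝓕) = V · (b − a)⁺`;
* **`integrableOn_and_setIntegral_indicator_sub_indicator`** — the signed shell identity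
  `∫_𝓕 (1_{‖x‖<1} − 1_{‖x‖<T⁻¹}) c dν = V log T · c` for every `T > 0`
  (Rogawski's "`m(F*\I_F^1) ∫_0^{e^{-T}} t^{s-2} dt`" at `s = 1`, pole removed);
* `setOf_ideleNorm_lt_one_inter_ae_eq`, `setOf_one_lt_ideleNorm_inter_ae_eq` — the shell
  `‖x‖ = 1` is `ν`-null inside `𝓕`, so `<` and `≤` cuts agree a.e.;
* `integrableOn_and_setIntegral_ideleNorm_lt_one` — `∫_{𝓕 ∩ {‖x‖ < 1}} ‖x‖ dν = V`
  (Tate's Lemma B at `s = 1` [CasselsFrohlichANT1967, Ch. XV Thm. 4.4.1 (proof)]);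
* `exists_norm_ideleSum_mul_rpow_le`, `exists_norm_ideleSum_le_mul_rpow_neg` — Meyer's Lemma 5.3
  as the sup bound `‖Σf(x)‖ ‖x‖^α ≤ C` [Meyer2005, Lemma 5.3]; `measurable_ideleSum`;
* **`integrableOn_ideleSum_mul_ideleNorm`**, **`integrableOn_ideleSum`** — `Σf(x) ‖x‖` and `Σg(x)`
  are `ν`-integrable on `𝓕 ∩ {‖x‖ ≥ 1}` ("the integrand decreases rapidly as `|a| → ∞`").

Cell `hodgecm-mathlib`, ENGINE T1 LAW 5 row (L5-i) (F0P3a-plan (g5) RULING #114; B-p17 (g18)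
piece E). HC_CM is proved only modulo the 7 printed citations until rung 0 closes — nothing here
bears on a summit statement.

## References
* [CasselsFrohlichANT1967] J. Tate, *Fourier analysis in number fields and Hecke's
  zeta-functions*, in Cassels–Fröhlich (eds.), *Algebraic Number Theory* (1967), Ch. XV,
  Thm. 4.3.2 and §4.4, proof of Thm. 4.4.1 (Lemma B).
* [Meyer2005] R. Meyer, *On a representation of the idele class group related to primes and zeros
  of L-functions*, Duke Math. J. 127 (2005), §5.3, Lemma 5.3.
* [Rogawski1990] J. D. Rogawski, *Automorphic Representations of Unitary Groups in Three
  Variables*, Ann. of Math. Stud. 123 (1990), §7.1, Lemma 7.1.1, pp. 89–90.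
-/

set_option autoImplicit false

noncomputable section

open MeasureTheory MeasureTheory.Measure NumberField IsDedekindDomain Set Filter
open scoped ENNReal NNReal Classical
open Literature.NumberTheory.Automorphic.Meyer

namespace Literature.NumberTheory.Automorphic

variable {K : Type} [Field K] [NumberField K]

/-! ### Volume computations inside an idele class domain -/

section Sets

/-- `{‖x‖ < r} = {log ‖x‖ < log r}` for `r > 0`. [folklore] -/
private theorem setOf_ideleNorm_lt_eq {r : ℝ} (hr : 0 < r) :
    {x : GaloisRepresentations.ideleGroup K | (IdeleClassGroup.ideleNorm K x : ℝ) < r} =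
      logNorm K ⁻¹' Iio (Real.log r) := by
  ext x
  simp only [mem_setOf_eq, mem_preimage, mem_Iio, logNorm]
  exact (Real.log_lt_log_iff (ideleNorm_real_pos x) hr).symm

/-- Pointwise: `1_{(-∞,a)} − 1_{(-∞,b)} = 1_{[b,a)} − 1_{[a,b)}` (one of the two is empty).
[folklore] -/
private theorem indicator_Iio_sub_indicator_Iio {E : Type*} [AddCommGroup E] (a b u : ℝ) (c : E) :
    (Iio a).indicator (fun _ => c) u - (Iio b).indicator (fun _ => c) u =
      (Ico b a).indicator (fun _ => c) u - (Ico a b).indicator (fun _ => c) u := by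
  by_cases ha : u < a <;> by_cases hb : u < b <;>
    simp [indicator_of_mem, indicator_of_notMem, ha, hb, not_lt.1, mem_Ico, mem_Iio]

end Sets

section Volume

variable [MeasurableSpace (GaloisRepresentations.ideleGroup K)]
  [BorelSpace (GaloisRepresentations.ideleGroup K)]
  (ν : Measure (GaloisRepresentations.ideleGroup K)) [ν.IsHaarMeasure]
  {𝓕 : Set (GaloisRepresentations.ideleGroup K)}

/-- **The measure of a logarithmic shell**: `ν({a ≤ log ‖x‖ < b} ∩ 𝓕) = V · (b − a)⁺`.
[cite: CasselsFrohlichANT1967, Ch. XV Thm. 4.3.2] -/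
theorem measure_logNorm_preimage_Ico_inter (h𝓕 : IsIdeleClassDomain K 𝓕) (a b : ℝ) :
    ν (logNorm K ⁻¹' Ico a b ∩ 𝓕) = idelicCovolume K ν * ENNReal.ofReal (b - a) := by
  rw [← normProfile_apply ν 𝓕 measurableSet_Ico,
    normProfile_eq_smul_volume ν (h𝓕.isFundamentalDomain ν), Measure.smul_apply, Real.volume_Ico,
    smul_eq_mul]

/-- The logarithmic shells inside `𝓕` have finite measure. [folklore] -/
private theorem measure_logNorm_preimage_Ico_inter_lt_top (h𝓕 : IsIdeleClassDomain K 𝓕) (a b : ℝ) :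
    ν (logNorm K ⁻¹' Ico a b ∩ 𝓕) < ∞ := by
  rw [measure_logNorm_preimage_Ico_inter ν h𝓕]
  exact ENNReal.mul_lt_top (idelicCovolume_lt_top ν) ENNReal.ofReal_lt_top

/-- **The signed shell identity**: for every `T > 0` and every constant `c`,
`∫_𝓕 (1_{‖x‖ < 1} − 1_{‖x‖ < T⁻¹}) c dν = V · log T · c` (for `T ≥ 1` this is
`ν(𝓕 ∩ {T⁻¹ ≤ ‖x‖ < 1}) = V log T`, Rogawski's
"`m(F*\I_F^1) ∫_0^{e^{-T}} t^{s-2} dt`" at `s = 1` after subtracting the pole; for `T < 1` the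
same with the opposite sign). [cite: Rogawski1990, §7.1 Lemma 7.1.1 (proof)] -/
theorem integrableOn_and_setIntegral_indicator_sub_indicator (h𝓕 : IsIdeleClassDomain K 𝓕)
    {T : ℝ} (hT : 0 < T) (c : ℂ) :
    IntegrableOn (fun x => {x | (IdeleClassGroup.ideleNorm K x : ℝ) < 1}.indicator (fun _ => c) x -
        {x | (IdeleClassGroup.ideleNorm K x : ℝ) < T⁻¹}.indicator (fun _ => c) x) 𝓕 ν ∧
      ∫ x in 𝓕, ({x | (IdeleClassGroup.ideleNorm K x : ℝ) < 1}.indicator (fun _ => c) x -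
          {x | (IdeleClassGroup.ideleNorm K x : ℝ) < T⁻¹}.indicator (fun _ => c) x) ∂ν =
        (((idelicCovolume K ν).toReal * Real.log T : ℝ) : ℂ) * c := by
  have hm : ∀ B : Set ℝ, MeasurableSet B →
      MeasurableSet (logNorm K ⁻¹' B : Set (GaloisRepresentations.ideleGroup K)) :=
    fun B hB => measurableSet_logNorm_preimage hB
  set L := Real.log T with hL
  have h1 : {x : GaloisRepresentations.ideleGroup K | (IdeleClassGroup.ideleNorm K x : ℝ) < 1} =
      logNorm K ⁻¹' Iio 0 := by
    rw [setOf_ideleNorm_lt_eq one_pos, Real.log_one]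
  have h2 : {x : GaloisRepresentations.ideleGroup K | (IdeleClassGroup.ideleNorm K x : ℝ) < T⁻¹} =
      logNorm K ⁻¹' Iio (-L) := by
    rw [setOf_ideleNorm_lt_eq (inv_pos.2 hT), Real.log_inv]
  rw [h1, h2]
  have hpt : (fun x : GaloisRepresentations.ideleGroup K =>
      (logNorm K ⁻¹' Iio 0).indicator (fun _ => c) x -
          (logNorm K ⁻¹' Iio (-L)).indicator (fun _ => c) x) =
        fun x => (logNorm K ⁻¹' Ico (-L) 0).indicator (fun _ => c) x -
          (logNorm K ⁻¹' Ico 0 (-L)).indicator (fun _ => c) x :=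
    funext fun x => indicator_Iio_sub_indicator_Iio 0 (-L) (logNorm K x) c
  rw [IntegrableOn, hpt]
  have hint : ∀ a b : ℝ,
      Integrable ((logNorm K ⁻¹' Ico a b).indicator fun _ => c) (ν.restrict 𝓕) := by
    intro a b
    rw [integrable_indicator_iff (hm _ measurableSet_Ico)]
    refine integrableOn_const ?_
    rw [Measure.restrict_apply (hm _ measurableSet_Ico)]
    exact (measure_logNorm_preimage_Ico_inter_lt_top ν h𝓕 a b).ne
  have hval : ∀ a b : ℝ, ∫ x in 𝓕, (logNorm K ⁻¹' Ico a b).indicator (fun _ => c) x ∂ν =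
      (((idelicCovolume K ν).toReal * max (b - a) 0 : ℝ) : ℂ) * c := by
    intro a b
    rw [integral_indicator_const c (hm _ measurableSet_Ico), measureReal_def,
      Measure.restrict_apply (hm _ measurableSet_Ico), measure_logNorm_preimage_Ico_inter ν h𝓕,
      ENNReal.toReal_mul, ENNReal.toReal_ofReal', Complex.real_smul]
  refine ⟨(hint _ _).sub (hint _ _), ?_⟩
  rw [integral_sub (hint _ _) (hint _ _), hval, hval]
  have hmax : max (0 - -L) 0 - max (-L - 0) 0 = L := by
    rw [sub_neg_eq_add, zero_add, sub_zero]
    rcases le_total 0 L with h | h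
    · rw [max_eq_left h, max_eq_right (neg_nonpos.2 h), sub_zero]
    · rw [max_eq_right h, max_eq_left (neg_nonneg.2 h)]; ring
  rw [← sub_mul, ← Complex.ofReal_sub, ← mul_sub, hmax]

/-- `𝓕 ∩ {‖x‖ < 1}` and `𝓕 ∩ {‖x‖ ≤ 1}` agree up to a `ν`-null set (`ν(𝓕 ∩ 𝕀_K¹) = 0`: the
norm-one ideles are null for `d𝔞 = d𝔟 · dt/t`). [cite: CasselsFrohlichANT1967, Ch. XV Thm. 4.3.2] -/
theorem setOf_ideleNorm_lt_one_inter_ae_eq (h𝓕 : IsIdeleClassDomain K 𝓕) :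
    ({x | (IdeleClassGroup.ideleNorm K x : ℝ) < 1} ∩ 𝓕 : Set (GaloisRepresentations.ideleGroup K))
      =ᵐ[ν] ({x | (IdeleClassGroup.ideleNorm K x : ℝ) ≤ 1} ∩ 𝓕 : Set _) := by
  refine ae_eq_set.2 ⟨?_, ?_⟩
  · refine measure_mono_null (fun x hx => (hx.2 ⟨?_, hx.1.2⟩).elim) measure_empty
    have h1 : (IdeleClassGroup.ideleNorm K x : ℝ) < 1 := hx.1.1
    show (IdeleClassGroup.ideleNorm K x : ℝ) ≤ 1
    exact h1.le
  · refine measure_mono_null (fun x hx => ?_)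
      (measure_setOf_ideleNorm_eq_one_inter_eq_zero ν (h𝓕.isFundamentalDomain ν))
    have h1 : (IdeleClassGroup.ideleNorm K x : ℝ) ≤ 1 := hx.1.1
    have h2 : ¬ (IdeleClassGroup.ideleNorm K x : ℝ) < 1 := fun h => hx.2 ⟨h, hx.1.2⟩
    exact ⟨le_antisymm h1 (not_lt.1 h2), hx.1.2⟩

/-- `𝓕 ∩ {1 < ‖x‖}` and `𝓕 ∩ {1 ≤ ‖x‖}` agree up to a `ν`-null set (`ν(𝓕 ∩ 𝕀_K¹) = 0`).
[cite: CasselsFrohlichANT1967, Ch. XV Thm. 4.3.2] -/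
theorem setOf_one_lt_ideleNorm_inter_ae_eq (h𝓕 : IsIdeleClassDomain K 𝓕) :
    ({x | 1 < (IdeleClassGroup.ideleNorm K x : ℝ)} ∩ 𝓕 : Set (GaloisRepresentations.ideleGroup K))
      =ᵐ[ν] ({x | 1 ≤ (IdeleClassGroup.ideleNorm K x : ℝ)} ∩ 𝓕 : Set _) := by
  refine ae_eq_set.2 ⟨?_, ?_⟩
  · refine measure_mono_null (fun x hx => (hx.2 ⟨?_, hx.1.2⟩).elim) measure_empty
    have h1 : 1 < (IdeleClassGroup.ideleNorm K x : ℝ) := hx.1.1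
    show 1 ≤ (IdeleClassGroup.ideleNorm K x : ℝ)
    exact h1.le
  · refine measure_mono_null (fun x hx => ?_)
      (measure_setOf_ideleNorm_eq_one_inter_eq_zero ν (h𝓕.isFundamentalDomain ν))
    have h1 : 1 ≤ (IdeleClassGroup.ideleNorm K x : ℝ) := hx.1.1
    have h2 : ¬ 1 < (IdeleClassGroup.ideleNorm K x : ℝ) := fun h => hx.2 ⟨h, hx.1.2⟩
    exact ⟨le_antisymm (not_lt.1 h2) h1, hx.1.2⟩

/-- **`∫_{𝓕 ∩ {‖x‖ < 1}} ‖x‖ dν = V`** (Tate's "`∫₀¹ κ t^s dt/t = κ/s`" at `s = 1`), with absolute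
convergence. [cite: CasselsFrohlichANT1967, Ch. XV Thm. 4.4.1 (proof, Lemma B)] -/
theorem integrableOn_and_setIntegral_ideleNorm_lt_one (h𝓕 : IsIdeleClassDomain K 𝓕) :
    IntegrableOn (fun x => ((IdeleClassGroup.ideleNorm K x : ℝ) : ℂ))
        ({x | (IdeleClassGroup.ideleNorm K x : ℝ) < 1} ∩ 𝓕) ν ∧
      ∫ x in {x | (IdeleClassGroup.ideleNorm K x : ℝ) < 1} ∩ 𝓕,
        ((IdeleClassGroup.ideleNorm K x : ℝ) : ℂ) ∂ν = (idelicCovolume K ν).toReal := by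
  have h := integrableOn_and_setIntegral_ideleNorm_cpow ν (h𝓕.isFundamentalDomain ν) (s := 1)
    (by norm_num)
  simp_rw [Complex.cpow_one, div_one] at h
  have hae := setOf_ideleNorm_lt_one_inter_ae_eq ν h𝓕
  exact ⟨h.1.congr_set_ae hae, by rw [setIntegral_congr_set hae, h.2]⟩

end Volume

/-! ### The Bruhat–Schwartz inputs: continuity, measurability and decay of `Σf` -/

section SchwartzBruhat

/-- A Bruhat–Schwartz function on `𝔸_K` is continuous. [cite: Meyer2005, §5.1] -/
theorem continuous_of_mem_schwartzBruhatAdele {f : AdeleRing (𝓞 K) K → ℂ}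
    (hf : f ∈ schwartzBruhatAdele K) : Continuous f :=
  (continuous_of_mem_piSchwartzBruhat (mem_schwartzBruhatAdele_iff.1 hf)).comp
    (continuous_pi fun _ => continuous_id)

/-- **Meyer's Lemma 5.3 as a sup bound**: for `f ∈ 𝒮(𝔸_K)` and `α > 1` there is `C` with
`‖Σf(x)‖ · ‖x‖^α ≤ C` for every idele `x`. [cite: Meyer2005, Lemma 5.3] -/
theorem exists_norm_ideleSum_mul_rpow_le {f : AdeleRing (𝓞 K) K → ℂ}
    (hf : f ∈ schwartzBruhatAdele K) {α : ℝ} (hα : 1 < α) :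
    ∃ C : ℝ, ∀ x : GaloisRepresentations.ideleGroup K,
      ‖ideleSum K f x‖ * (IdeleClassGroup.ideleNorm K x : ℝ) ^ α ≤ C := by
  obtain ⟨C, hC⟩ :=
    (mem_ideleClassSchwartz_iff.1 (weightMul_meyerSum_mem_ideleClassSchwartz hf hα)).decay 0 0
  refine ⟨C, fun x => ?_⟩
  have h := hC (x : IdeleClassGroup K)
  rw [show logWeight K 0 (x : IdeleClassGroup K) = 1 from pow_zero _, one_mul,
    norm_iteratedFDeriv_zero, archOrbit_apply_zero, weightMul_apply, meyerSum_mk, norm_mul,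
    Complex.norm_real, Real.norm_of_nonneg (Real.rpow_nonneg (NNReal.coe_nonneg _) _)] at h
  exact h

/-- The decay in the form used below: `‖Σf(x)‖ ≤ C · ‖x‖^{-α}` (`α > 1`).
[cite: Meyer2005, Lemma 5.3] -/
theorem exists_norm_ideleSum_le_mul_rpow_neg {f : AdeleRing (𝓞 K) K → ℂ}
    (hf : f ∈ schwartzBruhatAdele K) {α : ℝ} (hα : 1 < α) :
    ∃ C : ℝ, ∀ x : GaloisRepresentations.ideleGroup K,
      ‖ideleSum K f x‖ ≤ C * (IdeleClassGroup.ideleNorm K x : ℝ) ^ (-α) := by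
  obtain ⟨C, hC⟩ := exists_norm_ideleSum_mul_rpow_le hf hα
  refine ⟨C, fun x => ?_⟩
  have hpos : 0 < (IdeleClassGroup.ideleNorm K x : ℝ) ^ α := Real.rpow_pos_of_pos (ideleNorm_real_pos x) _
  rw [Real.rpow_neg (ideleNorm_real_pos x).le, ← div_eq_mul_inv, le_div_iff₀ hpos]
  exact hC x

variable [MeasurableSpace (GaloisRepresentations.ideleGroup K)]
  [BorelSpace (GaloisRepresentations.ideleGroup K)]

/-- Meyer's summation map `x ↦ Σf(x) = ∑_{a ∈ Kˣ} f(a x)` is Borel measurable on `𝕀_K` (a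
countable sum of continuous functions). [cite: Meyer2005, §5.3] -/
theorem measurable_ideleSum {f : AdeleRing (𝓞 K) K → ℂ} (hf : f ∈ schwartzBruhatAdele K) :
    Measurable (ideleSum K f) := by
  haveI : Countable Kˣ := by
    haveI := countable_numberField K
    exact Function.Injective.countable (f := (Units.val : Kˣ → K)) Units.val_injective
  have hc := continuous_of_mem_schwartzBruhatAdele hf
  refine Measurable.tsum fun a => ?_
  exact (hc.comp (continuous_const.mul Units.continuous_val)).measurable

variable (ν : Measure (GaloisRepresentations.ideleGroup K)) [ν.IsHaarMeasure]
  {𝓕 : Set (GaloisRepresentations.ideleGroup K)}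

/-- **Absolute convergence above the unit norm, with the weight `‖x‖`**: for `f ∈ 𝒮(𝔸_K)`,
`x ↦ Σf(x) ‖x‖` is integrable on `𝓕 ∩ {‖x‖ ≥ 1}` (decay `‖Σf(x)‖ ≤ C‖x‖^{-2}` against Tate's
`∫_{𝓕 ∩ {‖x‖≥1}} ‖x‖^{-1} dν = V`): "the integrand decreases rapidly as `|a|` tends to infinity".
[cite: Rogawski1990, §7.1 Lemma 7.1.1 (proof)] -/
theorem integrableOn_ideleSum_mul_ideleNorm (h𝓕 : IsIdeleClassDomain K 𝓕) {f : AdeleRing (𝓞 K) K → ℂ}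
    (hf : f ∈ schwartzBruhatAdele K) :
    IntegrableOn (fun x => ideleSum K f x * ((IdeleClassGroup.ideleNorm K x : ℝ) : ℂ))
      ({x | 1 ≤ (IdeleClassGroup.ideleNorm K x : ℝ)} ∩ 𝓕) ν := by
  obtain ⟨C, hC⟩ := exists_norm_ideleSum_le_mul_rpow_neg hf one_lt_two
  have hdom := (integrableOn_and_setIntegral_ideleNorm_cpow_neg ν (h𝓕.isFundamentalDomain ν)
    (s := 1) (by norm_num)).1
  refine Integrable.mono' (hdom.norm.const_mul C) ?_ (ae_of_all _ fun x => ?_)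
  · exact ((measurable_ideleSum hf).mul (Complex.continuous_ofReal.measurable.comp
      (NNReal.continuous_coe.measurable.comp (continuous_ideleNorm_holds K).measurable))).aestronglyMeasurable
  · have hx := ideleNorm_real_pos x
    rw [norm_mul, Complex.norm_real, Real.norm_of_nonneg hx.le,
      Complex.norm_cpow_eq_rpow_re_of_pos hx, Complex.neg_re, Complex.one_re]
    calc ‖ideleSum K f x‖ * (IdeleClassGroup.ideleNorm K x : ℝ)
        ≤ C * (IdeleClassGroup.ideleNorm K x : ℝ) ^ (-(2 : ℝ)) * (IdeleClassGroup.ideleNorm K x : ℝ) :=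
          mul_le_mul_of_nonneg_right (hC x) hx.le
      _ = C * (IdeleClassGroup.ideleNorm K x : ℝ) ^ (-(1 : ℝ)) := by
          rw [mul_assoc, ← Real.rpow_add_one hx.ne']; norm_num

/-- **Absolute convergence above the unit norm**: for `g ∈ 𝒮(𝔸_K)`, `Σg` is integrable on
`𝓕 ∩ {‖x‖ ≥ 1}` (applied to `g = 𝔉f`, again Bruhat–Schwartz).
[cite: Rogawski1990, §7.1 Lemma 7.1.1 (proof)] -/
theorem integrableOn_ideleSum (h𝓕 : IsIdeleClassDomain K 𝓕) {g : AdeleRing (𝓞 K) K → ℂ}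
    (hg : g ∈ schwartzBruhatAdele K) :
    IntegrableOn (ideleSum K g) ({x | 1 ≤ (IdeleClassGroup.ideleNorm K x : ℝ)} ∩ 𝓕) ν := by
  obtain ⟨C, hC⟩ := exists_norm_ideleSum_le_mul_rpow_neg hg one_lt_two
  have hdom := (integrableOn_and_setIntegral_ideleNorm_cpow_neg ν (h𝓕.isFundamentalDomain ν)
    (s := 2) (by norm_num)).1
  refine Integrable.mono' (hdom.norm.const_mul C) (measurable_ideleSum hg).aestronglyMeasurable
    (ae_of_all _ fun x => ?_)
  have hx := ideleNorm_real_pos x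
  rw [Complex.norm_cpow_eq_rpow_re_of_pos hx, Complex.neg_re]
  convert hC x using 3
  norm_num

end SchwartzBruhat

end Literature.NumberTheory.Automorphic
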